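import Summits.BirchSwinnertonDyer.Rank1Residual.X5.TwoAdicInstancesToolkit
import HarnessLib

/-!
# X5 at `p = 2` (cell `bsd-2adic`, seat `bsd-2adic-ord`): toolkit, part D — Silverman's minimality
# criterion through the prime factors of `gcd(Δ, c₄)`

One more bookkeeping lemma for the class-closure files (HONEST FRAMING as in
`X5/TwoAdicInstancesToolkit.lean`; nothing asserted): a prime `q` with `q¹² ∣ Δ` and `q⁴ ∣ c₄` divides
`gcd(Δ, c₄)`, so Silverman's sufficient criterion (AEC VII.1 Remark 1.1) only has to be checked at the
prime factors of `gcd(Δ, c₄)` — a `decide` on literal models. [SilvermanAEC2009] VII.1 Remark 1.1.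
-/

set_option autoImplicit false

namespace Summit.BirchSwinnertonDyer.Rank1Residual.X5.Instances

/-- **Silverman's criterion at the primes of `gcd(Δ, c₄)` only**: if `Δ ≠ 0` and no prime factor `q` of
`gcd(Δ, c₄)` has both `q¹² ∣ Δ` and `q⁴ ∣ c₄`, then no prime at all has. [cite: SilvermanAEC2009, VII.1 Remark 1.1] -/
theorem int_criterion_of_primeFactors_gcd {D C : ℤ} (hD : D ≠ 0)
    (h : ∀ q ∈ (Int.gcd D C).primeFactors, ¬ ((q : ℤ) ^ 12 ∣ D ∧ (q : ℤ) ^ 4 ∣ C)) (q : ℕ) (hq : q.Prime) :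
    ¬ ((q : ℤ) ^ 12 ∣ D ∧ (q : ℤ) ^ 4 ∣ C) := by
  rintro ⟨h12, h4⟩
  have hqD : (q : ℤ) ∣ D := (dvd_pow_self (q : ℤ) (by norm_num)).trans h12
  have hqC : (q : ℤ) ∣ C := (dvd_pow_self (q : ℤ) (by norm_num)).trans h4
  have hg : (q : ℤ) ∣ (Int.gcd D C : ℤ) := Int.dvd_coe_gcd hqD hqC
  have hg' : q ∣ Int.gcd D C := by exact_mod_cast hg
  have hg0 : Int.gcd D C ≠ 0 := fun h0 ↦ hD (Int.gcd_eq_zero_iff.mp h0).1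
  exact h q (Nat.mem_primeFactors.mpr ⟨hq, hg', hg0⟩) ⟨h12, h4⟩

end Summit.BirchSwinnertonDyer.Rank1Residual.X5.Instances
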